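import Summits.CriticalPhenomena.PercolationContinuityZ3.Theorems.PercAnnulusCrossingNoiseInfluence
import HarnessLib

/-!
# RSW3 lane (lead, gen 21): THE SPECTRAL SAMPLE OF A CROSSING, II — NOISE STABILITY BELOW THE TOTAL INFLUENCE:
# `E f² − E[f(ω)f(ω^ε)] = Σ_S (1 − (1−ε)^{|S|}) f̂(S)² ≤ ε·Σ_S |S| f̂(S)²` and `E[(f(ω) − f(ω^ε))²] ≤ 2ε·Σ_i p_i(1−p_i)E[(D_i f)²]`

builds on p205010 (kernel theorem, internal audit signed; external expert review pending) — NOT used in this file (abstract).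

Cell `prim-rsw3` (LANE 3), lead seat, gen 21.  Support file (`--supports stmt-CriticalPhenomena-4575`); no definitions, no named facts,
no sorries.  Setting of part I of this generation and gen 20's part IV (`…NoiseStability`): the ε-NOISED copy of `x ~ wt p` is
`ω^ε = (y on {m = 1}, x elsewhere)` with an independent `y ~ wt p` and an independent mask `m ~ wt ε̄` (each coordinate resampled from its own
bias with probability `ε`).  Gen 20 bounded the noise correlation `E[f(ω)f(ω^ε)] − E[f]²` from ABOVE by the revealment (sensitivity); this file
bounds it from BELOW by the total influence (stability), for every `p ∈ [0,1]^ι`: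

* §1 `sum_sum_sum_wt_noise_eq` — THE NOISED CONFIGURATION HAS THE PRODUCT LAW: `E[F(ω^ε)] = E[F(ω)]`; `sum_sum_sum_wt_mul_left` —
  `E_{x,y,m}[G(x)] = E[G]`; **`noise_sq_sub_eq`** — `E[(f(ω) − f(ω^ε))²] = 2·(E[f²] − E[f(ω)f(ω^ε)])` (for a 0/1-valued `f` the left side
  is `P(f(ω) ≠ f(ω^ε))`, Benjamini–Kalai–Schramm's stability functional `P[𝒜 Δ N_ε 𝒜]`).
* §2 (character systems) **`sq_sub_noise_correlation_eq_sum`** — `E[f²] − E[f(ω)f(ω^ε)] = Σ_S (1 − (1−ε)^{|S|})·f̂(S)²`;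
  `sq_sub_noise_correlation_nonneg` (`E[f f^ε] ≤ E[f²]`), **`sq_sub_noise_correlation_le`** — `E[f²] − E[f f^ε] ≤ ε·Σ_S |S|·f̂(S)²`
  (Bernoulli: `1 − (1−ε)^k ≤ kε`; O'Donnell Ex. 2.42 `NS_δ[f] ≤ δ·I[f]`), `noise_correlation_antitone` (`ε ↦ E[f f^ε]` is non-increasing).
* §3 NO CHARACTERS IN THE STATEMENTS (the p-biased system of gen 20's part I inside): **`sq_sub_noise_correlation_le_total_influence`** —
  `0 ≤ E_p[f²] − E_p[f(ω)f(ω^ε)] ≤ ε·Σ_i p_i(1−p_i)·E_p[(f(x^{i→1}) − f(x^{i→0}))²]`; **`noise_sq_sub_le_total_influence`** —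
  **`E_p[(f(ω) − f(ω^ε))²] ≤ 2ε·Σ_i p_i(1−p_i)·E_p[(f(x^{i→1}) − f(x^{i→0}))²]`**: an ε-noise changes a 0/1-valued monotone `f` with probability
  at most `2ε·Σ_i p_i(1−p_i)P(i pivotal)` — NOISE STABILITY BELOW THE PIVOTAL SCALE (the easy half of Garban–Pete–Schramm: the spectral
  sample is no larger than the pivotal set in mean); `noise_correlation_antitone'`.

References: I. Benjamini, G. Kalai, O. Schramm, Publ. IHÉS 90 (1999) §1.4 (stability, `P[𝒜 Δ N_ε𝒜]`), Thm 1.9; R. O'Donnell, *Analysis of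
Boolean Functions* (CUP 2014) §2.4 Prop 2.51 (`d Stab_ρ/dρ |_{ρ=1} = I[f]`, monotonicity), Ex. 2.42 (`NS_δ ≤ δ I`), §8.3–8.4; C. Garban,
J. Steif, CUP 2014, Ch. I Def I.10 (noise stability), Ch. IV §3 (the spectral formulas; `Cov(f(ω), f(ω_ε))` is nonnegative and decreasing
in `ε`), Prop IV.2–IV.3; C. Garban, G. Pete, O. Schramm, Acta Math. 205 (2010) Thm 1.1 (for planar crossings the spectral sample has the size
of the pivotal set).
-/

noncomputable section

namespace Summit.CriticalPhenomena.PercolationContinuityZ3.Theorems.Crossing.Spectral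

open Finset Function
open Literature.Probability.ODonnellSaksSchrammServedio2005

variable {ι : Type*} [Fintype ι] [DecidableEq ι]

/-! ## §1 The noised configuration has the product law; the squared noise difference -/

omit [DecidableEq ι] in
/-- **THE NOISED CONFIGURATION HAS THE PRODUCT LAW**: `E_{x,y,m}[F(ω^ε)] = E_x[F(x)]` (for a fixed mask, exchanging the masked coordinates of
the two samples preserves `wt ⊗ wt`, gen 20's `sum_sum_wt_mask_swap`; then `Σ_m wt ε̄ m = 1`).
[cite: ODonnell2014, §2.4 Def 2.40 (if x is uniform and y is ρ-correlated to x then y is uniform; p-biased §8.4)] -/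
theorem sum_sum_sum_wt_noise_eq [DecidableEq ι] (p : ι → ℝ) (ε : ℝ) (F : (ι → Bool) → ℝ) :
    ∑ x : ι → Bool, ∑ y : ι → Bool, ∑ m : ι → Bool, wt p x * wt p y * wt (fun _ => ε) m
        * F (fun i => if m i = true then y i else x i)
      = ∑ x : ι → Bool, wt p x * F x := by
  -- a fixed mask
  have hfix : ∀ m : ι → Bool,
      ∑ x : ι → Bool, ∑ y : ι → Bool, wt p x * wt p y * F (fun i => if m i = true then y i else x i)
        = ∑ x : ι → Bool, wt p x * F x := by
    intro m
    rw [sum_sum_wt_mask_swap p m]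
    refine (Finset.sum_congr rfl fun x _ => Finset.sum_congr rfl fun y _ => ?_).trans (sum_sum_wt_mul_left p F)
    congr 2
    funext i
    by_cases hm : m i = true <;> simp [hm]
  calc ∑ x : ι → Bool, ∑ y : ι → Bool, ∑ m : ι → Bool, wt p x * wt p y * wt (fun _ => ε) m
          * F (fun i => if m i = true then y i else x i)
      = ∑ m : ι → Bool, wt (fun _ => ε) m * ∑ x : ι → Bool, ∑ y : ι → Bool, wt p x * wt p y
          * F (fun i => if m i = true then y i else x i) := by
        rw [Finset.sum_congr rfl (fun x (_ : x ∈ (Finset.univ : Finset (ι → Bool))) => Finset.sum_comm), Finset.sum_comm]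
        simp only [Finset.mul_sum]
        exact Finset.sum_congr rfl fun m _ => Finset.sum_congr rfl fun x _ => Finset.sum_congr rfl fun y _ => by ring
    _ = ∑ m : ι → Bool, wt (fun _ => ε) m * ∑ x : ι → Bool, wt p x * F x := by
        exact Finset.sum_congr rfl fun m _ => by rw [hfix m]
    _ = ∑ x : ι → Bool, wt p x * F x := by
        rw [← Finset.sum_mul, sum_wt, one_mul]

omit [DecidableEq ι] in
/-- `E_{x,y,m}[G(x)] = E[G]` (the second sample and the mask integrate to `1`). [cite: ODonnell2014, §8.4 (p-biased product distribution)] -/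
theorem sum_sum_sum_wt_mul_left [DecidableEq ι] (p : ι → ℝ) (ε : ℝ) (G : (ι → Bool) → ℝ) :
    ∑ x : ι → Bool, ∑ y : ι → Bool, ∑ m : ι → Bool, wt p x * wt p y * wt (fun _ => ε) m * G x
      = ∑ x : ι → Bool, wt p x * G x := by
  refine Finset.sum_congr rfl fun x _ => ?_
  have hm : ∀ y : ι → Bool, ∑ m : ι → Bool, wt p x * wt p y * wt (fun _ => ε) m * G x = wt p x * wt p y * G x := by
    intro y
    have : ∑ m : ι → Bool, wt p x * wt p y * wt (fun _ => ε) m * G x = (wt p x * wt p y * G x) * ∑ m : ι → Bool, wt (fun _ => ε) m := by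
      rw [Finset.mul_sum]; exact Finset.sum_congr rfl fun m _ => by ring
    rw [this, sum_wt, mul_one]
  rw [Finset.sum_congr rfl (fun y _ => hm y)]
  have : ∑ y : ι → Bool, wt p x * wt p y * G x = (wt p x * G x) * ∑ y : ι → Bool, wt p y := by
    rw [Finset.mul_sum]; exact Finset.sum_congr rfl fun y _ => by ring
  rw [this, sum_wt, mul_one]

omit [DecidableEq ι] in
/-- **THE SQUARED NOISE DIFFERENCE**: `E[(f(ω) − f(ω^ε))²] = 2·(E[f²] − E[f(ω)·f(ω^ε)])` (both marginals have law `wt p`).  For a 0/1-valued `f`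
the left side is `P(f(ω) ≠ f(ω^ε))` — Benjamini–Kalai–Schramm's `P[𝒜 Δ N_ε𝒜]`.
[cite: BenjaminiKalaiSchramm1999, §1.4 (stability: P[𝒜 Δ N_ε𝒜])] [cite: GarbanSteif2014, Ch. I Def I.10 (noise stability via P(f(ω) ≠ f(ω_ε)))] -/
theorem noise_sq_sub_eq [DecidableEq ι] (p : ι → ℝ) (ε : ℝ) (f : (ι → Bool) → ℝ) :
    ∑ x : ι → Bool, ∑ y : ι → Bool, ∑ m : ι → Bool, wt p x * wt p y * wt (fun _ => ε) m
        * (f x - f (fun i => if m i = true then y i else x i)) ^ 2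
      = 2 * ((∑ x : ι → Bool, wt p x * (f x * f x))
          - ∑ x : ι → Bool, ∑ y : ι → Bool, ∑ m : ι → Bool, wt p x * wt p y * wt (fun _ => ε) m
              * (f x * f (fun i => if m i = true then y i else x i))) := by
  have hexp : ∀ x y m : ι → Bool, wt p x * wt p y * wt (fun _ => ε) m * (f x - f (fun i => if m i = true then y i else x i)) ^ 2
      = wt p x * wt p y * wt (fun _ => ε) m * (f x * f x)
        + wt p x * wt p y * wt (fun _ => ε) m
            * ((fun z : ι → Bool => f z * f z) (fun i => if m i = true then y i else x i))
        - 2 * (wt p x * wt p y * wt (fun _ => ε) m * (f x * f (fun i => if m i = true then y i else x i))) := by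
    intro x y m; ring
  simp only [hexp, Finset.sum_add_distrib, Finset.sum_sub_distrib, ← Finset.mul_sum]
  rw [sum_sum_sum_wt_noise_eq p ε (fun z => f z * f z), sum_sum_sum_wt_mul_left p ε (fun z => f z * f z)]
  ring

/-! ## §2 Spectrally: the stability deficit against the total influence -/

section Levels

variable {p : ι → ℝ} {r : ι → Bool → ℝ}
  (hH1 : ∀ i, p i * r i true + (1 - p i) * r i false = 0)
  (hH2 : ∀ i (b b' : Bool), coordWt p i b ≠ 0 → coordWt p i b' * (1 + r i b * r i b') = if b' = b then 1 else 0)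

include hH1 hH2 in
/-- **THE STABILITY DEFICIT, SPECTRALLY**: `E[f²] − E[f(ω)f(ω^ε)] = Σ_S (1 − (1−ε)^{|S|})·f̂(S)²` (Parseval minus the spectral formula of gen 20).
[cite: GarbanSteif2014, Ch. IV §3 (E[f(ω)f(ω_ε)] = Σ_S f̂(S)²(1−ε)^{|S|})] [cite: ODonnell2014, §2.4 Thm 2.49 / §8.4 Prop 8.28] -/
theorem sq_sub_noise_correlation_eq_sum (f : (ι → Bool) → ℝ) (ε : ℝ) :
    (∑ x : ι → Bool, wt p x * (f x * f x))
        - ∑ x : ι → Bool, ∑ y : ι → Bool, ∑ m : ι → Bool, wt p x * wt p y * wt (fun _ => ε) m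
            * (f x * f (fun i => if m i = true then y i else x i))
      = ∑ S ∈ (Finset.univ : Finset ι).powerset,
          (1 - (1 - ε) ^ S.card) * (∑ x : ι → Bool, wt p x * (f x * ∏ i ∈ S, r i (x i))) ^ 2 := by
  rw [sum_wt_mul_sq_eq_sum_coeff_sq hH2 f, noise_correlation_eq_sum_coeff_sq hH1 hH2 f ε, ← Finset.sum_sub_distrib]
  exact Finset.sum_congr rfl fun S _ => by ring

include hH1 hH2 in
/-- `E[f(ω)f(ω^ε)] ≤ E[f²]` for `0 ≤ ε ≤ 1` (termwise `(1−ε)^{|S|} ≤ 1`). [cite: GarbanSteif2014, Ch. IV §3 (the covariance is nonnegative and decreasing in ε)] -/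
theorem sq_sub_noise_correlation_nonneg (f : (ι → Bool) → ℝ) {ε : ℝ} (hε0 : 0 ≤ ε) (hε1 : ε ≤ 1) :
    0 ≤ (∑ x : ι → Bool, wt p x * (f x * f x))
        - ∑ x : ι → Bool, ∑ y : ι → Bool, ∑ m : ι → Bool, wt p x * wt p y * wt (fun _ => ε) m
            * (f x * f (fun i => if m i = true then y i else x i)) := by
  rw [sq_sub_noise_correlation_eq_sum hH1 hH2 f ε]
  refine Finset.sum_nonneg fun S _ => mul_nonneg ?_ (sq_nonneg _)
  have : (1 - ε) ^ S.card ≤ 1 := pow_le_one₀ (by linarith) (by linarith)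
  linarith

include hH1 hH2 in
/-- **THE STABILITY DEFICIT IS AT MOST `ε` TIMES THE TOTAL INFLUENCE**: for `0 ≤ ε ≤ 1`,
`E[f²] − E[f(ω)f(ω^ε)] ≤ ε·Σ_S |S|·f̂(S)²` (Bernoulli's inequality `1 − (1−ε)^k ≤ kε` termwise; with part I the right side is
`ε·Σ_i p_i(1−p_i)E[(D_i f)²]`).  [cite: ODonnell2014, §2.4 Prop 2.51 and Ex. 2.42 (NS_δ[f] ≤ δ·I[f])] [cite: GarbanSteif2014, Ch. IV §3 Prop IV.3 (noise stability from the spectrum)] -/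
theorem sq_sub_noise_correlation_le (f : (ι → Bool) → ℝ) {ε : ℝ} (hε1 : ε ≤ 1) :
    (∑ x : ι → Bool, wt p x * (f x * f x))
        - ∑ x : ι → Bool, ∑ y : ι → Bool, ∑ m : ι → Bool, wt p x * wt p y * wt (fun _ => ε) m
            * (f x * f (fun i => if m i = true then y i else x i))
      ≤ ε * ∑ S ∈ (Finset.univ : Finset ι).powerset, (S.card : ℝ) * (∑ x : ι → Bool, wt p x * (f x * ∏ i ∈ S, r i (x i))) ^ 2 := by
  rw [sq_sub_noise_correlation_eq_sum hH1 hH2 f ε, Finset.mul_sum]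
  refine Finset.sum_le_sum fun S _ => ?_
  have hB : 1 - (1 - ε) ^ S.card ≤ (S.card : ℝ) * ε := by
    have h := one_add_mul_le_pow (show (-2 : ℝ) ≤ -ε by linarith) S.card
    have : (1 + -ε) = 1 - ε := by ring
    rw [this] at h
    linarith
  calc (1 - (1 - ε) ^ S.card) * (∑ x : ι → Bool, wt p x * (f x * ∏ i ∈ S, r i (x i))) ^ 2
      ≤ ((S.card : ℝ) * ε) * (∑ x : ι → Bool, wt p x * (f x * ∏ i ∈ S, r i (x i))) ^ 2 :=
        mul_le_mul_of_nonneg_right hB (sq_nonneg _)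
    _ = ε * ((S.card : ℝ) * (∑ x : ι → Bool, wt p x * (f x * ∏ i ∈ S, r i (x i))) ^ 2) := by ring

include hH1 hH2 in
/-- **MONOTONICITY OF THE NOISE CORRELATION**: for `ε ≤ ε' ≤ 1`, `E[f(ω)f(ω^{ε'})] ≤ E[f(ω)f(ω^ε)]` (termwise `(1−ε')^{|S|} ≤ (1−ε)^{|S|}`).
[cite: GarbanSteif2014, Ch. IV §3 (Cov(f(ω), f(ω_ε)) is nonnegative and decreasing in ε)] [cite: ODonnell2014, §2.4 Prop 2.51 (Stab_ρ is increasing in ρ)] -/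
theorem noise_correlation_antitone (f : (ι → Bool) → ℝ) {ε ε' : ℝ} (hεε' : ε ≤ ε') (hε'1 : ε' ≤ 1) :
    ∑ x : ι → Bool, ∑ y : ι → Bool, ∑ m : ι → Bool, wt p x * wt p y * wt (fun _ => ε') m
          * (f x * f (fun i => if m i = true then y i else x i))
      ≤ ∑ x : ι → Bool, ∑ y : ι → Bool, ∑ m : ι → Bool, wt p x * wt p y * wt (fun _ => ε) m
          * (f x * f (fun i => if m i = true then y i else x i)) := by
  rw [noise_correlation_eq_sum_coeff_sq hH1 hH2 f ε, noise_correlation_eq_sum_coeff_sq hH1 hH2 f ε']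
  refine Finset.sum_le_sum fun S _ => mul_le_mul_of_nonneg_right ?_ (sq_nonneg _)
  exact pow_le_pow_left₀ (by linarith) (by linarith) _

end Levels

/-! ## §3 Statements free of characters (the p-biased system inside) -/

/-- **NOISE STABILITY BELOW THE TOTAL INFLUENCE** (every `p ∈ [0,1]^ι`, `0 ≤ ε ≤ 1`):
**`0 ≤ E_p[f²] − E_p[f(ω)·f(ω^ε)] ≤ ε·Σ_i p_i(1−p_i)·E_p[(f(x^{i→1}) − f(x^{i→0}))²]`** — the stability deficit of the noise correlation is at most
`ε` times the total influence (for 0/1-valued monotone `f`: `ε·Σ_i p_i(1−p_i)·P(i pivotal)`).  Compare gen 20's UPPER bound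
`E[f f^ε] − E[f]² ≤ m²δE[f²] + (1−ε)^{m+1}Var f` by the revealment `δ`: the noise correlation of `f` is squeezed between its total influence
and its revealment. [cite: ODonnell2014, §2.4 Prop 2.51, Ex. 2.42 (NS_δ[f] ≤ δ·I[f]); §8.4 Prop 8.45]
[cite: GarbanSteif2014, Ch. IV §3 Prop IV.3] [cite: GarbanPeteSchramm2010, Thm 1.1 (the spectral sample vs the pivotal set)] -/
theorem sq_sub_noise_correlation_le_total_influence (p : ι → ℝ) (h0 : ∀ i, 0 ≤ p i) (h1 : ∀ i, p i ≤ 1)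
    (f : (ι → Bool) → ℝ) {ε : ℝ} (hε0 : 0 ≤ ε) (hε1 : ε ≤ 1) :
    0 ≤ (∑ x : ι → Bool, wt p x * (f x * f x))
        - ∑ x : ι → Bool, ∑ y : ι → Bool, ∑ m : ι → Bool, wt p x * wt p y * wt (fun _ => ε) m
            * (f x * f (fun i => if m i = true then y i else x i)) ∧
      (∑ x : ι → Bool, wt p x * (f x * f x))
        - ∑ x : ι → Bool, ∑ y : ι → Bool, ∑ m : ι → Bool, wt p x * wt p y * wt (fun _ => ε) m
            * (f x * f (fun i => if m i = true then y i else x i))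
        ≤ ε * ∑ i, p i * (1 - p i) * ∑ x : ι → Bool, wt p x * (f (update x i true) - f (update x i false)) ^ 2 := by
  have hH1 := pbiased_H1 p
  have hH2 := pbiased_H2 p h0 h1
  refine ⟨sq_sub_noise_correlation_nonneg hH1 hH2 f hε0 hε1, ?_⟩
  rw [sum_bias_mul_sum_sq_eq_sum_card_mul_coeff_sq hH1 hH2 f]
  exact sq_sub_noise_correlation_le hH1 hH2 f hε1

/-- **AN ε-NOISE RARELY CHANGES A FUNCTION OF SMALL TOTAL INFLUENCE** (every `p ∈ [0,1]^ι`, `0 ≤ ε ≤ 1`):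
**`E_p[(f(ω) − f(ω^ε))²] ≤ 2ε·Σ_i p_i(1−p_i)·E_p[(f(x^{i→1}) − f(x^{i→0}))²]`**; for a 0/1-valued monotone `f` this reads
`P_p(f(ω) ≠ f(ω^ε)) ≤ 2ε·Σ_i p_i(1−p_i)·P_p(i pivotal)` — on the lattice `2ε·p(1−p)·E_p[N_piv]`: NOISE STABILITY BELOW THE PIVOTAL SCALE.
[cite: BenjaminiKalaiSchramm1999, §1.4 (uniform stability: P[𝒜 Δ N_ε𝒜] small uniformly)] [cite: ODonnell2014, §2.4 Ex. 2.42 (NS_δ[f] ≤ δ·I[f])]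
[cite: GarbanSteif2014, Ch. I Def I.10] -/
theorem noise_sq_sub_le_total_influence (p : ι → ℝ) (h0 : ∀ i, 0 ≤ p i) (h1 : ∀ i, p i ≤ 1)
    (f : (ι → Bool) → ℝ) {ε : ℝ} (hε0 : 0 ≤ ε) (hε1 : ε ≤ 1) :
    ∑ x : ι → Bool, ∑ y : ι → Bool, ∑ m : ι → Bool, wt p x * wt p y * wt (fun _ => ε) m
        * (f x - f (fun i => if m i = true then y i else x i)) ^ 2
      ≤ 2 * ε * ∑ i, p i * (1 - p i) * ∑ x : ι → Bool, wt p x * (f (update x i true) - f (update x i false)) ^ 2 := by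
  rw [noise_sq_sub_eq p ε f]
  have h := (sq_sub_noise_correlation_le_total_influence p h0 h1 f hε0 hε1).2
  nlinarith

/-- **THE NOISE CORRELATION IS NON-INCREASING IN `ε`** (every `p ∈ [0,1]^ι`, `ε ≤ ε' ≤ 1`): `E_p[f(ω)f(ω^{ε'})] ≤ E_p[f(ω)f(ω^ε)]`;
hence noise sensitivity at one level `ε₀` gives it at every `ε ≥ ε₀`, and stability at `ε₀` gives it at every `ε ≤ ε₀`.
[cite: GarbanSteif2014, Ch. IV §3 (decreasing in ε) and Prop IV.2 (sensitivity does not depend on ε)] [cite: ODonnell2014, §2.4 Prop 2.51] -/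
theorem noise_correlation_antitone' (p : ι → ℝ) (h0 : ∀ i, 0 ≤ p i) (h1 : ∀ i, p i ≤ 1) (f : (ι → Bool) → ℝ)
    {ε ε' : ℝ} (hεε' : ε ≤ ε') (hε'1 : ε' ≤ 1) :
    ∑ x : ι → Bool, ∑ y : ι → Bool, ∑ m : ι → Bool, wt p x * wt p y * wt (fun _ => ε') m
          * (f x * f (fun i => if m i = true then y i else x i))
      ≤ ∑ x : ι → Bool, ∑ y : ι → Bool, ∑ m : ι → Bool, wt p x * wt p y * wt (fun _ => ε) m
          * (f x * f (fun i => if m i = true then y i else x i)) :=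
  noise_correlation_antitone (pbiased_H1 p) (pbiased_H2 p h0 h1) f hεε' hε'1

end Summit.CriticalPhenomena.PercolationContinuityZ3.Theorems.Crossing.Spectral

end
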